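import Mathlib
import Literature.Computability.AlgebraicComplexity.NewtonPolygonTauProofs
import Summits.ValiantsHypothesis.ValiantsHypothesis.Theorems.NewtonFramesNewtonTauWeakSlopeLadderBlocking

/-!
# Crux `NewtonTauWeak` (stmt-ValiantsHypothesis-5904), line `landing-collapse`: the BENCHMARK TRANSFER
`ThreeSetBound → BlockConvexBound`

The line `Cruxes/NewtonTauWeak/Lines/landing_collapse.lean` (val-idea-12 g0) bears on the rung `BeatTwoThirds` of the
line of record `slope_ladder` through its OPEN stub `BlockConvexBound` (the `M_r(N)` problem of [BBFKOTT10 §5] for some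
`r ≥ 2` with exponent `(2/3 - δ) r`, `δ > 0`) and the LANDED `SlopeLadderBlocking.stub_blocking` (p578760).  Its crux is
`ThreeSetBound` ("sumsets are not EPRS-extremal"): for some `η > 0`, every convexly independent subset of
`P₁ + P₂ + Y` with `#P₁, #P₂ ≤ n`, `#Y ≤ n²` has `≤ C (n+2)^{8/3 - η}` points.

This file lands the line's PROVED transfer step, statements written out over tree-visible constants
(`open scoped Pointwise`, no new `Prop` definitions):

* `blockConvexBound_of_threeSetBound` — `ThreeSetBound → BlockConvexBound` with the witness `r = 4`, `δ = η/4`,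
  obtained by grouping `Y := P 2 + P 3` (`#Y ≤ N²` by `Finset.card_add_le`; `∑_{i<4} P i = P 0 + P 1 + (P 2 + P 3)` by
  `Fin.sum_univ_four`; `(2/3 - η/4)·4 = 8/3 - η`);
* `beatTwoThirds_of_threeSetBound` — hence `ThreeSetBound → BeatTwoThirds` (`∃ c < 2/3, SlopeBound c`), composing with
  `SlopeLadderBlocking.stub_blocking` BY NAME.

Both are IMPLICATIONS from the open `ThreeSetBound`; nothing here proves `ThreeSetBound`, `BlockConvexBound`, the rung, the
crux `NewtonTauWeak`, or anything about `VP ≠ VNP` (the rung is FRONTIER-disposition convex geometry two residuals below the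
crux).  Helper for the crux item (`--supports`).
-/

set_option linter.dupNamespace false

namespace Summit.ValiantsHypothesis.ValiantsHypothesis.Theorems.NewtonFramesNewtonTauWeak.LandingCollapse

open scoped BigOperators Pointwise
open MvPolynomial
open Literature.Computability.AlgebraicComplexity (newtonVertexCount)

noncomputable section

/-- **Benchmark transfer (`U2` of line `landing-collapse`), verbatim:** `ThreeSetBound → BlockConvexBound`.
If for some `η > 0` and `C` every convexly independent `S ⊆ P₁ + P₂ + Y` with `#P₁, #P₂ ≤ n`, `#Y ≤ n²` has
`#S ≤ C (n+2)^{8/3 - η}`, then the block-convexity input of `SlopeLadderBlocking.stub_blocking` holds with `r = 4`,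
`δ = η/4` and the same `C`: given `P : Fin 4 → Finset (Fin 2 → ℝ)` with `#P i ≤ N`, group `Y := P 2 + P 3`
(`#Y ≤ N²`) and use `∑ i, P i = P 0 + P 1 + (P 2 + P 3)`, `(2/3 - η/4)·4 = 8/3 - η`. [folklore] -/
theorem blockConvexBound_of_threeSetBound
    (h : ∃ (η C : ℝ), 0 < η ∧
      ∀ (n : ℕ) (P₁ P₂ Y S : Finset (Fin 2 → ℝ)),
        P₁.card ≤ n → P₂.card ≤ n → Y.card ≤ n ^ 2 → S ⊆ P₁ + P₂ + Y →
          ConvexIndependent ℝ (Subtype.val : ↥(S : Set (Fin 2 → ℝ)) → (Fin 2 → ℝ)) →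
            (S.card : ℝ) ≤ C * ((n : ℝ) + 2) ^ ((8 : ℝ) / 3 - η)) :
    ∃ (r : ℕ) (δ C : ℝ), 2 ≤ r ∧ 0 < δ ∧
      ∀ (N : ℕ) (P : Fin r → Finset (Fin 2 → ℝ)) (S : Finset (Fin 2 → ℝ)),
        (∀ i, (P i).card ≤ N) → S ⊆ ∑ i, P i →
          ConvexIndependent ℝ (Subtype.val : ↥(S : Set (Fin 2 → ℝ)) → (Fin 2 → ℝ)) →
            (S.card : ℝ) ≤ C * ((N : ℝ) + 2) ^ ((2 / 3 - δ) * (r : ℝ)) := by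
  classical
  obtain ⟨η, C, hη, h⟩ := h
  refine ⟨4, η / 4, C, by norm_num, by positivity, ?_⟩
  intro N P S hP hS hconv
  have hY : (P 2 + P 3).card ≤ N ^ 2 := by
    calc (P 2 + P 3).card ≤ (P 2).card * (P 3).card := Finset.card_add_le
      _ ≤ N * N := Nat.mul_le_mul (hP 2) (hP 3)
      _ = N ^ 2 := (sq N).symm
  have hsum : ∑ i, P i = P 0 + P 1 + (P 2 + P 3) := by
    rw [Fin.sum_univ_four, add_assoc]
  have hS' : S ⊆ P 0 + P 1 + (P 2 + P 3) := hsum ▸ hS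
  have hmain := h N (P 0) (P 1) (P 2 + P 3) S (hP 0) (hP 1) hY hS' hconv
  have hexp : ((2 : ℝ) / 3 - η / 4) * ((4 : ℕ) : ℝ) = (8 : ℝ) / 3 - η := by push_cast; ring
  rw [hexp]
  exact hmain

/-- **The rung from the line's crux, Theorems-side:** `ThreeSetBound → BeatTwoThirds`, i.e. the three-set incidence
bound gives `∃ c < 2/3, SlopeBound c` — `blockConvexBound_of_threeSetBound` followed by the landed
`SlopeLadderBlocking.stub_blocking` (KPTT's block argument [KoiranPortierTavenasThomasse2015, §4]).  CONDITIONAL on its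
hypothesis (the open `ThreeSetBound`); it does not touch the crux `NewtonTauWeak`. [folklore] -/
theorem beatTwoThirds_of_threeSetBound
    (h : ∃ (η C : ℝ), 0 < η ∧
      ∀ (n : ℕ) (P₁ P₂ Y S : Finset (Fin 2 → ℝ)),
        P₁.card ≤ n → P₂.card ≤ n → Y.card ≤ n ^ 2 → S ⊆ P₁ + P₂ + Y →
          ConvexIndependent ℝ (Subtype.val : ↥(S : Set (Fin 2 → ℝ)) → (Fin 2 → ℝ)) →
            (S.card : ℝ) ≤ C * ((n : ℝ) + 2) ^ ((8 : ℝ) / 3 - η)) :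
    ∃ c : ℝ, c < 2 / 3 ∧
      ∃ (C : ℝ) (b : ℕ), ∀ (k m t : ℕ) (f : Fin k → Fin m → MvPolynomial (Fin 2) ℂ),
        (∀ i j, (f i j).support.card ≤ t) →
          (newtonVertexCount (∑ i, ∏ j, f i j) : ℝ) ≤
            C * ((k : ℝ) + 2) ^ b * 2 ^ (b * m) * ((t : ℝ) + 2) ^ b * ((t : ℝ) + 2) ^ (c * (m : ℝ)) :=
  SlopeLadderBlocking.stub_blocking (blockConvexBound_of_threeSetBound h)

end

end Summit.ValiantsHypothesis.ValiantsHypothesis.Theorems.NewtonFramesNewtonTauWeak.LandingCollapse
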